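import Summits.Parity.GeneralizedHardyLittlewood.Theses.VarianceWitness

/-!
# Birth skeleton (BC3) — crux stmt-Parity-18096 `Theses.VarianceWitness.TwistedVarianceRate` (rank 3)
# line `birth`: the two classical MODULUS REGIMES of the twisted class variance —
# Gallagher's range `q ≤ x^{κ₀(ε,B)}` (Landau–Siegel with a rate) and the individual-modulus
# Barban–Davenport–Halberstam range `x^{κ₀} < q ≤ x^{1−κ}` (Hooley's range, with a rate)

Registered by the skeleton registrar (planner one-shot `planner-skel-stmt-Parity-18096-0`,
2026-08-17; BC3 of `run/shared/lean/lens3/_common/BC.md`) for route `route-Parity-VarianceWitness`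
(rev 13; `closes (hI : InverseDicksonUniform) (hV : TwistedVarianceRate) : GeneralizedHardyLittlewood`).
It is the decomposition the route header announces under TWO-LAYER PLAN
("TwistedVarianceRate ⇐ SmallModuli → LargeModuli → TwistedVarianceRate, the rev-2 composition with
the rate threaded through") and that NOT DECOMPOSED YET left "to a seat whose unit names those items".
Two NAMED stubs, the kernel-checked composition `TwistedVarianceRate_of` concluding the crux BY NAME,
the two converse restrictions (so the file PROVES `TwistedVarianceRate ↔ SmallModuli ∧ LargeModuli`:
neither stub over-claims), and `twistedVarianceRate_of_stubs` plugging the stubs in.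

## The crux (FIXED; verbatim the route decl)

Write `V_Λ(x;q,τ) := Σ_{b mod q, (b,q)=1} |Σ_{n ≤ x, n ≡ b (q)} Λ(n) n^{−iτ} − (1/φ(q)) Σ_{n ≤ x, (n,q)=1} Λ(n) n^{−iτ}|²`
(inlined Finset form; by orthogonality `V_Λ(x;q,τ) = (1/φ(q)) Σ_{χ ≠ χ₀ mod q} |ψ(x, χ̄, τ)|²`).
`TwistedVarianceRate`: for every `κ, ε > 0` and every `B : ℕ` there is `x₀` with
`V_Λ(x;q,τ) ≤ ε x² / (φ(q) (log log x)^B)` for all `x ≥ x₀`, `1 ≤ q ≤ x^{1−κ}`, `|τ| ≤ x`.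

## The cut — by the size of the modulus, at a level `x^{κ₀}` that may shrink with `(ε, B)`

* `stub_smallModuli` (S, OPEN — GALLAGHER'S RANGE WITHOUT THE EXCEPTIONAL TERM, with a log-log
  rate): for every `ε > 0`, `B` there are `κ₀ > 0` and `x₀` with the bound for all `x ≥ x₀`,
  `1 ≤ q ≤ x^{κ₀}`, `|τ| ≤ x`. At `B = 0` this is exactly the shape of Gallagher's prime number
  theorem in progressions (relative error `exp(−c log x / log q) ≤ ε` for `q ≤ x^{c/log(1/ε)}`,
  zeros to height `T = x` for the twist) MINUS its Siegel term: true iff exceptional zeros of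
  quadratic `L(s,χ)`, `cond χ ≤ x^{κ₀}`, do not bias the classes by relative size `≥ ε` — i.e.
  Landau–Siegel in Gallagher's range (it refutes `UnboundedSiegelZeros` at `τ = 0`); at `B ≥ 1` it
  asks in addition that NO zero of `L(s,χ)`, `cond χ ≤ x^{κ₀}`, `|γ| ≤ x`, has
  `(1 − β) log x ≤ (B/2) log log log x + O(1)` — an expanding zero-free box holding only polylog-many
  candidate zeros (log-free density), so a pure zero-FREE-REGION statement.
  Why it might fail: Landau–Siegel; one real zero at `1 − A log log log q / log q`. Sources:
  Gallagher1970 (Thm 7), MontgomeryVaughan2007 (§11.3, Thm 11.16 ff.), FriedlanderIwaniec (Opera de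
  Cribro, ch. 24), HeathBrown1983PrimeTwins.
* `stub_largeModuli` (L, OPEN — INDIVIDUAL-MODULUS BARBAN–DAVENPORT–HALBERSTAM IN HOOLEY'S RANGE,
  twisted, with a log-log rate): for every `κ₀, κ > 0`, `ε > 0`, `B` there is `x₀` with the bound for
  all `x ≥ x₀`, `x^{κ₀} < q ≤ x^{1−κ}`, `|τ| ≤ x`. Here `φ(q)` is a power of `x`, log-free density is
  useless (too many characters), and the statement is a genuine MEAN-SQUARE law over the `φ(q) − 1`
  non-principal characters: `Σ_{χ ≠ χ₀} |ψ(x,χ,τ)|² ≤ ε x² (log log x)^{−B}`. Known on average over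
  `q ≤ Q` (Barban, Davenport–Halberstam, Montgomery, Hooley I–XIX: `V_Λ ∼ x log q` on average), for
  individual `q` only when `q ≥ x/(log x)^A` (Friedlander–Goldston 1996, Fiorilli–Martin); Hooley's
  conjecture `V_Λ(x;q) ∼ x log q` for individual `q` in this range implies it with room `x^{−κ} log x
  (log log x)^B`; GRH implies it for every `B`. Why it might fail: it improves the Brun–Titchmarsh
  constant to `o(1)` in quadratic mean over classes for every individual power modulus (beyond every
  unconditional equidistribution result for an individual `q > (log x)^A`); `(log q)^C` zeros at
  `1 − O(log log q / log q)` for one conductor `q ∈ (x^{κ₀}, x^{1−κ}]` break it. Sources: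
  Hooley1975BDH1, FriedlanderGoldston1996, FiorilliMartin2020 (arXiv:2008.05837),
  GoldstonSuriajaya2021 (arXiv:2104.09407 §7), MontgomeryVaughan2007, Literature.Barriers.Parity.BrunTitchmarshSiegelZero.

Composition `TwistedVarianceRate_of : S → L → TwistedVarianceRate` (REAL proof, this file): given
`(κ, ε, B)` take `κ₀ = κ₀(ε, B)` and `x₁` from S, `x₂` from L at `(κ₀, κ, ε, B)`, `x₀ := max x₁ x₂`, and
split `q ≤ x^{κ₀}` / `x^{κ₀} < q`. Converses (no `sorry`): `smallModuli_of_tvr` (S is the crux at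
`κ = 1/2`, `κ₀ = 1/2`) and `largeModuli_of_tvr` (restriction), hence `tvr_iff_small_and_large`.
Neither stub gives the crux or the summit cheaply (BC3 probes in the registrar's NOTES.md:
`stub → TwistedVarianceRate`, `stub → GeneralizedHardyLittlewood` by
`first | exact? | simpa | aesop` all FAIL — S lacks every power range `q > x^{κ₀}`, L lacks
`q ≤ x^{o(1)}`, and `closes` needs the other crux `InverseDicksonUniform`).

Disproof.lean: none exists for this crux (`ledger crux ls stmt-Parity-18096`: no workfiles at
registration) — no `_false_without_` obligations; the birth crux-attack (refuter
rattack-stmt-Parity-18096, CRUX-ATTACK.md) found: drop `q ≤ x^{1−κ}` ⇒ false (diagonal), drop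
`|τ| ≤ x` ⇒ false (Kronecker) — both caps are kept verbatim in both stubs. Negatives index
(3 entries: ConvMomentLevelOne, InverseSieveTuplesTupleElliott, RectangleChowla): none concerns
primes in progressions / character sums. Barriers: `Literature.Barriers.Parity.BrunTitchmarshSiegelZero`
and the Siegel entries (`SiegelZeroPrimePairBarrier`, `SiegelZeroTwinPrimes`) — NOT evaded, by
design: S is the route's declared Landau–Siegel content (necessary at `(B,τ) = (0,0)` by the support
`ClassVarianceOfGHL`), L its beyond-Siegel–Walfisz equidistribution content; `SelbergParityBarrier`,
`PrimePairParity`, `LogarithmicAveraging` — not in their classes (no sieve, no correlations of λ).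
-/

set_option linter.dupNamespace false

noncomputable section

open scoped BigOperators Classical

namespace Summit.Parity.GeneralizedHardyLittlewood.Cruxes.TwistedVarianceRate.Birth

open Summit.Parity.GeneralizedHardyLittlewood.Theses.VarianceWitness (TwistedVarianceRate)

/-! ## Legend: the two stub statements as named propositions (verbatim the registered signatures) -/

/-- Statement of `stub_smallModuli` (S): the twisted class-variance bound with a log-log rate for
moduli `q ≤ x^{κ₀}`, the exponent `κ₀ > 0` allowed to depend on `(ε, B)`. -/
def Sig.stub_smallModuli : Prop :=
  ∀ ε : ℝ, 0 < ε → ∀ B : ℕ, ∃ κ₀ : ℝ, 0 < κ₀ ∧ ∃ x₀ : ℕ, ∀ x : ℕ, x₀ ≤ x → ∀ q : ℕ, 1 ≤ q → (q : ℝ) ≤ (x : ℝ) ^ κ₀ → ∀ τ : ℝ, |τ| ≤ x → (∑ b ∈ (Finset.range q).filter (fun b => Nat.Coprime b q), ‖(∑ n ∈ (Finset.Icc 1 x).filter (fun n => n % q = b), (ArithmeticFunction.vonMangoldt n : ℂ) * Complex.exp (-(τ * Real.log n) * Complex.I)) - (∑ n ∈ (Finset.Icc 1 x).filter (fun n =>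 Nat.Coprime n q), (ArithmeticFunction.vonMangoldt n : ℂ) * Complex.exp (-(τ * Real.log n) * Complex.I)) / (Nat.totient q : ℂ)‖ ^ 2) ≤ ε * (x : ℝ) ^ 2 / ((Nat.totient q : ℝ) * Real.log (Real.log x) ^ B)

/-- Statement of `stub_largeModuli` (L): the twisted class-variance bound with a log-log rate for
moduli `x^{κ₀} < q ≤ x^{1−κ}`, for every `κ₀, κ > 0`. -/
def Sig.stub_largeModuli : Prop :=
  ∀ κ₀ : ℝ, 0 < κ₀ → ∀ κ : ℝ, 0 < κ → ∀ ε : ℝ, 0 < ε → ∀ B : ℕ, ∃ x₀ : ℕ, ∀ x : ℕ, x₀ ≤ x → ∀ q : ℕ, 1 ≤ q → (x : ℝ) ^ κ₀ < (q : ℝ) → (q : ℝ) ≤ (x : ℝ) ^ (1 - κ) → ∀ τ : ℝ, |τ| ≤ x → (∑ b ∈ (Finset.range q).filter (fun b => Nat.Coprime b q), ‖(∑ n ∈ (Finset.Icc 1 x).filter (fun n => n % q = b), (ArithmeticFunction.vonMangoldt n : ℂ) * Complex.exp (-(τ * Real.log n) * Complex.I)) - (∑ n ∈ (Finset.Icc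 1 x).filter (fun n => Nat.Coprime n q), (ArithmeticFunction.vonMangoldt n : ℂ) * Complex.exp (-(τ * Real.log n) * Complex.I)) / (Nat.totient q : ℂ)‖ ^ 2) ≤ ε * (x : ℝ) ^ 2 / ((Nat.totient q : ℝ) * Real.log (Real.log x) ^ B)

/-! ## Registered stubs (`sorry` only here; signatures def-free and self-contained) -/

/-- **S — SMALL MODULI: Gallagher's range without the exceptional term, twisted, with a log-log
rate.** For every `ε > 0` and `B : ℕ` there are `κ₀ > 0` and `x₀` such that for all `x ≥ x₀`, all
`1 ≤ q ≤ x^{κ₀}` and all `|τ| ≤ x`: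
`Σ_{b, (b,q)=1} |ψ(x;q,b,τ) − ψ_q(x,τ)/φ(q)|² ≤ ε x² / (φ(q) (log log x)^B)`.
At `B = 0`: Gallagher's PNT in progressions (zeros to height `x`) minus its Siegel term — true iff
no exceptional-zero bias of relative size `≥ ε` at conductors `≤ x^{κ₀(ε)}` (Landau–Siegel in
Gallagher's range; refutes `UnboundedSiegelZeros`). At `B ≥ 1`: no zero of `L(s,χ)`,
`cond χ ≤ x^{κ₀}`, `|γ| ≤ x`, with `(1−β) log x ≤ (B/2) log log log x + O(1)` (only polylog-many
candidates by log-free density: a zero-free-REGION statement). Why it might fail: Landau–Siegel;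
one real zero at `1 − A log log log q / log q`. Sources: Gallagher1970, MontgomeryVaughan2007,
HeathBrown1983PrimeTwins, FriedlanderGranvilleHildebrandMaier1991. Size: open-problem. -/
theorem stub_smallModuli : ∀ ε : ℝ, 0 < ε → ∀ B : ℕ, ∃ κ₀ : ℝ, 0 < κ₀ ∧ ∃ x₀ : ℕ, ∀ x : ℕ, x₀ ≤ x → ∀ q : ℕ, 1 ≤ q → (q : ℝ) ≤ (x : ℝ) ^ κ₀ → ∀ τ : ℝ, |τ| ≤ x → (∑ b ∈ (Finset.range q).filter (fun b => Nat.Coprime b q), ‖(∑ n ∈ (Finset.Icc 1 x).filter (fun n => n % q = b), (ArithmeticFunction.vonMangoldt n : ℂ) * Complex.exp (-(τ * Real.log n) * Complex.I)) - (∑ n ∈ (Finset.Icc 1 x).filter (fun n => Nat.Coprime n q), (ArithmeticFunction.vonMangoldt n : ℂ) * Complex.exp (-(τ * Real.log n) * Complex.I)) / (Nat.totient q : ℂ)‖ ^ 2) ≤ ε * (x : ℝ) ^ 2 / ((Nat.totient q : ℝ) * Real.log (Real.log x) ^ B) := by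
  sorry

/-- **L — LARGE MODULI: individual-modulus Barban–Davenport–Halberstam in Hooley's range, twisted,
with a log-log rate.** For every `κ₀ > 0`, `κ > 0`, `ε > 0` and `B : ℕ` there is `x₀` such that for
all `x ≥ x₀`, all `q` with `x^{κ₀} < q ≤ x^{1−κ}` and all `|τ| ≤ x`:
`Σ_{b, (b,q)=1} |ψ(x;q,b,τ) − ψ_q(x,τ)/φ(q)|² ≤ ε x² / (φ(q) (log log x)^B)`, i.e. the mean-square
law `Σ_{χ ≠ χ₀ mod q} |ψ(x,χ,τ)|² ≤ ε x² (log log x)^{−B}` over a power of `x` many characters.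
Implied (with room `x^{−κ} log x (log log x)^B`) by Hooley's conjecture `V_Λ(x;q) ∼ x log q`,
twisted, and by GRH for every `B`; known only on average over `q` (BDH, Hooley) or for
`q ≥ x/(log x)^A` (Friedlander–Goldston). Why it might fail: it is an `o(1)` Brun–Titchmarsh
constant in quadratic mean for EVERY individual power modulus, beyond all unconditional results
for individual `q > (log x)^A`; `(log q)^C` low zeros for one conductor in the range break it.
Sources: Hooley1975BDH1, FriedlanderGoldston1996, FiorilliMartin2020, GoldstonSuriajaya2021,
MontgomeryVaughan2007. Size: open-problem. -/
theorem stub_largeModuli : ∀ κ₀ : ℝ, 0 < κ₀ → ∀ κ : ℝ, 0 < κ → ∀ ε : ℝ, 0 < ε → ∀ B : ℕ, ∃ x₀ : ℕ, ∀ x : ℕ, x₀ ≤ x → ∀ q : ℕ, 1 ≤ q → (x : ℝ) ^ κ₀ < (q : ℝ) → (q : ℝ) ≤ (x : ℝ) ^ (1 - κ) → ∀ τ : ℝ, |τ| ≤ x → (∑ b ∈ (Finset.range q).filter (fun b => Nat.Coprime b q), ‖(∑ n ∈ (Finset.Icc 1 x).filter (fun n => n % q = b), (ArithmeticFunction.vonMangoldt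 n : ℂ) * Complex.exp (-(τ * Real.log n) * Complex.I)) - (∑ n ∈ (Finset.Icc 1 x).filter (fun n => Nat.Coprime n q), (ArithmeticFunction.vonMangoldt n : ℂ) * Complex.exp (-(τ * Real.log n) * Complex.I)) / (Nat.totient q : ℂ)‖ ^ 2) ≤ ε * (x : ℝ) ^ 2 / ((Nat.totient q : ℝ) * Real.log (Real.log x) ^ B) := by
  sorry

/-! ## Composition: the crux BY NAME from the two stubs (real proof, no `sorry`) -/

/-- **TwistedVarianceRate from S and L.** Given `(κ, ε, B)`, take `κ₀ = κ₀(ε, B)` and `x₁` from S and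
`x₂` from L at `(κ₀, κ, ε, B)`; for `x ≥ max x₁ x₂` split the modulus at `x^{κ₀}`. -/
theorem TwistedVarianceRate_of : Sig.stub_smallModuli → Sig.stub_largeModuli → TwistedVarianceRate := by
  intro hS hL κ hκ ε hε B
  obtain ⟨κ₀, hκ₀, x₁, hx₁⟩ := hS ε hε B
  obtain ⟨x₂, hx₂⟩ := hL κ₀ hκ₀ κ hκ ε hε B
  refine ⟨max x₁ x₂, ?_⟩
  intro x hx q hq1 hqx τ hτ
  rcases le_or_gt (q : ℝ) ((x : ℝ) ^ κ₀) with hsmall | hlarge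
  · -- small modulus: `q ≤ x^{κ₀}`
    exact hx₁ x (le_trans (le_max_left _ _) hx) q hq1 hsmall τ hτ
  · -- large modulus: `x^{κ₀} < q ≤ x^{1-κ}`
    have hlarge' : (x : ℝ) ^ κ₀ < (q : ℝ) := hlarge
    exact hx₂ x (le_trans (le_max_right _ _) hx) q hq1 hlarge' hqx τ hτ

/-! ## Converses (no `sorry`): neither stub over-claims — each is a restriction of the crux -/

/-- S is the crux at `κ = 1/2` with `κ₀ := 1/2` (any `κ₀ < 1` would do). -/
theorem smallModuli_of_tvr (h : TwistedVarianceRate) : Sig.stub_smallModuli := by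
  intro ε hε B
  obtain ⟨x₀, hx₀⟩ := h (1 / 2) (by norm_num) ε hε B
  refine ⟨1 / 2, by norm_num, x₀, ?_⟩
  intro x hx q hq1 hqx τ hτ
  have hhalf : (1 : ℝ) - 1 / 2 = 1 / 2 := by norm_num
  exact hx₀ x hx q hq1 (by rw [hhalf]; exact hqx) τ hτ

/-- L is the crux restricted to `x^{κ₀} < q`. -/
theorem largeModuli_of_tvr (h : TwistedVarianceRate) : Sig.stub_largeModuli := by
  intro κ₀ _ κ hκ ε hε B
  obtain ⟨x₀, hx₀⟩ := h κ hκ ε hε B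
  exact ⟨x₀, fun x hx q hq1 _ hqx τ hτ => hx₀ x hx q hq1 hqx τ hτ⟩

/-- The cut is exact: `TwistedVarianceRate ↔ S ∧ L`. -/
theorem tvr_iff_small_and_large :
    TwistedVarianceRate ↔ (Sig.stub_smallModuli ∧ Sig.stub_largeModuli) :=
  ⟨fun h => ⟨smallModuli_of_tvr h, largeModuli_of_tvr h⟩, fun h => TwistedVarianceRate_of h.1 h.2⟩

/-- The crux by name, closed modulo the two registered stubs (checks that the `Sig.*` legend is the
stub signatures verbatim). -/
theorem twistedVarianceRate_of_stubs : TwistedVarianceRate :=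
  TwistedVarianceRate_of stub_smallModuli stub_largeModuli

end Summit.Parity.GeneralizedHardyLittlewood.Cruxes.TwistedVarianceRate.Birth

end
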